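import Summits.CriticalPhenomena.PercolationContinuityZ3.Theorems.PercNearOneGluingNoHeavyLowerTailSahiCTCRtThreeSlots
import HarnessLib

/-!
# `NoHeavyLowerTail` (crux stmt-CriticalPhenomena-4575), P3 lane: DEFINITIONS for the squarefree row of `R_3` as a bilinear form and for
# SEPARABLE CERTIFICATES (memo g49 §3)

Support file (seat `prim-l12-p3`, gen 49; `--supports stmt-CriticalPhenomena-4575`).  Memo
`run/shared/lean/prim/prim-l12/FROM-prim-l12-p3-g49-SEPARABLE-CERTIFICATES.md` §3.
This file only holds the definitions used by `…RtThreeBilinear`, `…RtThreeAtoms`, `…RtThreeCorners`, `…RtThreeSepCert`, `…RtThreeCertEight`: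

* `ι`, `ιq` : membership indicators of a family (values in `ℤ`, `ℚ`);
* `Mrow V S S'` : the matrix of the squarefree row, `[s^V] R_3(𝒳,𝒵) = Σ_{S,S' ⊆ V} [S ∈ 𝒳][S' ∈ 𝒵]·Mrow V S S'`
  (`coeff_ind_Rt_three_eq_bilinear`, next file); `Mtype a b c o` : the same as a function of the TYPE
  `(a,b,c) = (#(S∩S'), #(S∖S'), #(S'∖S))` and `o = #(V∖(S∪S'))`; `theta2 m = #{U : #U ≤ 2}` of an `m`-set;
* `atomΩ`, `atomSum` : SINGLE-STEP ATOMS `(A, u, B, w)` (`u ∉ A`, `w ∉ B`, inside `V`) carry `([A+u ∈ 𝒳] − [A ∈ 𝒳])·([B+w ∈ 𝒵] − [B ∈ 𝒵]) ≥ 0`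
  for up-sets; they are weighted by five tables `wJ wX wOx wOz wOO : ℕ → ℕ → ℕ → ℚ` evaluated at the type of the top corner `(A+u, B+w)`,
  the table being chosen by the position of `u, w` (`J` : `u = w`; `X` : `u ∈ B+w`, `w ∈ A+u`; `Ox` : only `w ∈ A+u`; `Oz` : only `u ∈ B+w`;
  `OO` : neither);
* `sepE` : the coefficient of `[S ∈ 𝒳][S' ∈ 𝒵]` in the weighted atom sum as a function of the type (`atomSum_eq_sum_sepE`);
* `tab` : a finite weight table (association list, default `0`), used to write the certificates.
Nothing is asserted about the crux.
-/

noncomputable section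

open scoped Classical

namespace Summit.CriticalPhenomena.PercolationContinuityZ3.Theorems.SahiCTCForms

open Finset MvPolynomial SahiCTCGenFun

/-! ### Type-level functions (no ground set) -/

/-- `θ₂(m) = 1 + m + C(m,2)`, the number of subsets of size `≤ 2` of an `m`-set. [this work] -/
def theta2 (m : ℕ) : ℕ := 1 + m + m.choose 2

/-- The matrix of the squarefree row as a function of the type `(a,b,c)` and of `o = #(V ∖ (S ∪ S'))`. [this work] -/
def Mtype (a b c o : ℕ) : ℚ :=
  (if b = 0 ∧ c = 0 ∧ 3 ≤ a then (theta2 o : ℚ) else 0) - (if a = 0 ∧ o ≤ 2 then 1 else 0)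
    + (if a = 0 ∧ a + b < 3 ∧ a + c < 3 then 1 else 0)

/-- The coefficient of `[S ∈ 𝒳][S' ∈ 𝒵]` in the weighted atom sum, as a function of the type `(a,b,c)` of `(S,S')` and of `o = #(V ∖ (S ∪ S'))`:
the four corners with signs `+ − − +` (memo g49 §3.3, top-corner form). [this work] -/
def sepE (wJ wX wOx wOz wOO : ℕ → ℕ → ℕ → ℚ) (a b c o : ℕ) : ℚ :=
  ((a : ℚ) * wJ a b c + ((a : ℚ) * a - a) * wX a b c + (b : ℚ) * a * wOx a b c + (a : ℚ) * c * wOz a b c + (b : ℚ) * c * wOO a b c)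
  - ((b : ℚ) * wJ (a + 1) (b - 1) c + (a : ℚ) * b * wX (a + 1) (b - 1) c + ((b : ℚ) * b - b) * wOx (a + 1) (b - 1) c
      + (a : ℚ) * o * wOz a b (c + 1) + (b : ℚ) * o * wOO a b (c + 1))
  - ((c : ℚ) * wJ (a + 1) b (c - 1) + (a : ℚ) * c * wX (a + 1) b (c - 1) + ((c : ℚ) * c - c) * wOz (a + 1) b (c - 1)
      + (a : ℚ) * o * wOx a (b + 1) c + (c : ℚ) * o * wOO a (b + 1) c)
  + ((b : ℚ) * c * wX (a + 2) (b - 1) (c - 1) + (c : ℚ) * o * wOz (a + 1) b c + (b : ℚ) * o * wOx (a + 1) b c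
      + (o : ℚ) * wJ (a + 1) b c + ((o : ℚ) * o - o) * wOO a (b + 1) (c + 1))

/-- A finite weight table: the value at `(a,b,c)` of an association list, default `0`. [this work] -/
def tab (l : List ((ℕ × ℕ × ℕ) × ℚ)) (a b c : ℕ) : ℚ := (l.lookup (a, b, c)).getD 0

/-! ### Indicators, the matrix of the squarefree row, atoms -/

variable {α : Type*} [DecidableEq α]

/-- Membership indicator with values in `ℤ`. [this work] -/
def ι (F : Finset (Finset α)) (S : Finset α) : ℤ := if S ∈ F then 1 else 0

/-- Membership indicator with values in `ℚ`. [this work] -/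
def ιq (F : Finset (Finset α)) (S : Finset α) : ℚ := if S ∈ F then 1 else 0

/-- The matrix of the squarefree row: `M_V(S,S') = [S = S', 3 ≤ #S]·#{U ⊆ V∖S : #U ≤ 2} − [S ∩ S' = ∅, #(V∖(S∪S')) ≤ 2] + [S ∩ S' = ∅, #S, #S' < 3]`.
[this work] -/
def Mrow (V S S' : Finset α) : ℤ :=
  (if S = S' ∧ 3 ≤ #S then (#((V \ S).powerset.filter fun U => #U ≤ 2) : ℤ) else 0)
    - (if Disjoint S S' ∧ #(V \ (S ∪ S')) ≤ 2 then 1 else 0)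
    + (if Disjoint S S' ∧ #S < 3 ∧ #S' < 3 then 1 else 0)

/-- The weight of the atom with top corner `(S, S')` and step points `u ∈ S`, `v ∈ S'`, by kind:
`J` (`u = v`), `X` (`u ∈ S'`, `v ∈ S`), `Ox` (`u ∉ S'`, `v ∈ S`), `Oz` (`u ∈ S'`, `v ∉ S`), `OO` (neither); each weight is a function
of the type `(#(S ∩ S'), #(S ∖ S'), #(S' ∖ S))`. [this work] -/
def atomΩ (wJ wX wOx wOz wOO : ℕ → ℕ → ℕ → ℚ) (S : Finset α) (u : α) (S' : Finset α) (v : α) : ℚ :=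
  if u = v then wJ #(S ∩ S') #(S \ S') #(S' \ S)
  else if u ∈ S' ∧ v ∈ S then wX #(S ∩ S') #(S \ S') #(S' \ S)
  else if v ∈ S then wOx #(S ∩ S') #(S \ S') #(S' \ S)
  else if u ∈ S' then wOz #(S ∩ S') #(S \ S') #(S' \ S)
  else wOO #(S ∩ S') #(S \ S') #(S' \ S)

/-- The weighted sum over all single-step atoms `(A, u, B, v)` inside `V` (`u ∉ A`, `v ∉ B`) of
`([A+u ∈ 𝒳] − [A ∈ 𝒳])·([B+v ∈ 𝒵] − [B ∈ 𝒵])`, weighted by `atomΩ` at the top corner `(A+u, B+v)`. [this work] -/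
def atomSum (wJ wX wOx wOz wOO : ℕ → ℕ → ℕ → ℚ) (F G : Finset (Finset α)) (V : Finset α) : ℚ :=
  ∑ A ∈ V.powerset, ∑ u ∈ V \ A, ∑ B ∈ V.powerset, ∑ v ∈ V \ B,
    atomΩ wJ wX wOx wOz wOO (insert u A) u (insert v B) v * ((ιq F (insert u A) - ιq F A) * (ιq G (insert v B) - ιq G B))

end Summit.CriticalPhenomena.PercolationContinuityZ3.Theorems.SahiCTCForms
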